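import Mathlib
import HarnessLib.Audit
import Summits.PneNP.PneNP.Theorems.PstarCrossCasePEmptyToggle
import Summits.PneNP.PneNP.Theorems.PstarGateUnitCycleRankSix
import Summits.PneNP.PneNP.Theorems.PstarRankRigidity

/-!
# The blind free CROSS gate, node N1, step 3: RANK SIX from three controlled edges, `q_{(0,1)} ∈ {0, q_{(1,0)}}`, and the FIRST constraint touches no controlled edge (O2 / E1; prover-1 g22)

FRONTIER range-avoidance ladder, rung F-N3 (`stmt-PneNP-19007`), cell `pnp-ideate`; restricted-model proof complexity — nothing here bears on `P` versus `NP`.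

Node N1 (`(N.erase e_q).erase e_p = ∅`), regime P, `q = q_{(1,0)}` with polar form `β = polarDir I B (1,0)`, `g₁ = q_{(0,1)} = F₁ + t₁`.

* `qDir01_zero_of_q` — **`Z(q) ⊆ Z(g₁)`**: with no real chord besides the gate chords the all-ON obstruction of `PstarCrossCaseP.qDir01_of_q` reads
  `g₁ ≡ 1 + 1 = 0` on `Z(q)`;
* `rank_six_of_controlled` — three distinct CONTROLLED private edges with `c_j = 1` are three pairwise `β`-orthogonal hyperbolic pairs
  (`PstarGateUnitCycleRankSix.finrank_rad_add_six_le`): `β` has radical of codimension `≥ 6`;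
* **`qDir01_dichotomy`** — then `g₁ ≡ 0` or `g₁ = q` (`PstarRankRigidity.eq_zero_or_eq_of_rank_six`);
* **`w₁_untouched`** — in either case the first constraint reads NEITHER AND variable of a controlled private edge (no linear read:
  `PstarGateCasePUnitsTouch.not_mem_C_of_qDir`; no monomial: `PstarCrossCornerReads.avoid_of_polar_zero_off_mate` with the join `T₁` and `G₁`).
With steps 1–2 (`PstarCrossCasePEmptyW2`, `…Toggle`: good ⟹ controlled, `c_j = 1` on the good private edges of `D_p Δ D_q`) and `PstarCrossBudget.cross_touch`,
node N1 is reduced to the configurations with fewer than three good private edges of `D_p Δ D_q` with `c_j = 1`, i.e. to the planner's pinned classes.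
-/

set_option linter.dupNamespace false -- `Summit.PneNP.PneNP.…`: summit = sub-problem name (D-0017 single-conjunct layout)

open Finset Module Literature.Computability.Complexity
open Summit.PneNP.PneNP.Theorems.PstarFibrePolys (bit)
open Summit.PneNP.PneNP.Theorems.PstarTyped (Typed)
open Summit.PneNP.PneNP.Theorems.PstarSALevel (varSet BoundaryExpanding SimpleOverlap)
open Summit.PneNP.PneNP.Theorems.PstarCentreFree (vars_mem_varSet)
open Summit.PneNP.PneNP.Theorems.PstarCubeIdeals (IsQuadFn)
open Summit.PneNP.PneNP.Theorems.PstarQuadRank (rad)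
open Summit.PneNP.PneNP.Theorems.PstarProductRank (qform polar)
open Summit.PneNP.PneNP.Theorems.PstarPathRank (AndAdj polar_basis)
open Summit.PneNP.PneNP.Theorems.PstarReadSumset (V2)
open Summit.PneNP.PneNP.Theorems.PstarChordSystem (ChordSystem)
open Summit.PneNP.PneNP.Theorems.PstarChordBridgeTools
open Summit.PneNP.PneNP.Theorems.PstarChordBridge
open Summit.PneNP.PneNP.Theorems.PstarChordBridgeForcing (freeMon freePolar gam)
open Summit.PneNP.PneNP.Theorems.PstarChordBridgeBasis (qDir polarDir)
open Summit.PneNP.PneNP.Theorems.PstarChordBridgeCorner (qDir_add)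
open Summit.PneNP.PneNP.Theorems.PstarGateCasePUnitsTouch (not_mem_C_of_qDir polarDir_single)
open Summit.PneNP.PneNP.Theorems.PstarGateUnitCycleRankSix (finrank_rad_add_six_le)
open Summit.PneNP.PneNP.Theorems.PstarRankRigidity (eq_zero_or_eq_of_rank_six)
open Summit.PneNP.PneNP.Theorems.PstarCrossData (CrossData)
open Summit.PneNP.PneNP.Theorems.PstarCrossSystem
open Summit.PneNP.PneNP.Theorems.PstarCrossCorner (PrivEdge)
open Summit.PneNP.PneNP.Theorems.PstarCrossCornerReads (avoid_of_polar_zero_off_mate)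
open Summit.PneNP.PneNP.Theorems.PstarCrossCaseP (qDir01_of_q)
open Summit.PneNP.PneNP.Theorems.PstarCrossCasePEmptyToggle (Controlled cval polarDir_self polarDir_symm)

namespace Summit.PneNP.PneNP.Theorems.PstarCrossCasePEmptyW1

variable {n m : ℕ}

section

variable (I : LocalMap 4 n m) {r : ℕ} {B : BridgeData n m} {e_p e_q g₀ : Fin m}

/-- **`Z(q_{(1,0)}) ⊆ Z(q_{(0,1)})`** in node N1 (no real chord besides the gate chords). -/
theorem qDir01_zero_of_q (hI : I.IsPure xorAndPred) (hT : Typed I) (hD : CrossData I r B e_p e_q g₀) (hSR : ((sys I B).vsys e_p e_q).SingleRead)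
    (hE : (B.N.erase e_q).erase e_p = ∅) {a : Fin n → ZMod 2} (ha : qDir I B (1, 0) a = 0) : qDir I B (0, 1) a = 0 := by
  classical
  have h := qDir01_of_q I hI hT hD hSR ha
  have hN : B.N.erase e_q = {e_p} := by
    have hpe : e_p ∈ B.N.erase e_q := mem_erase.2 ⟨hD.ne, hD.mem_p⟩
    rw [← insert_erase hpe, hE]; rfl
  rw [hN, sum_singleton, (vsys_reads_p I hD a).1, (vsys_reads_p I hD a).2] at h
  rw [h]; decide

/-- **Three controlled private edges with `c_j = 1` give rank six.** -/
theorem rank_six_of_controlled {j₁ j₂ j₃ : Fin m} (h₁ : Controlled I B j₁) (h₂ : Controlled I B j₂) (h₃ : Controlled I B j₃)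
    (h12 : j₁ ≠ j₂) (h13 : j₁ ≠ j₃) (h23 : j₂ ≠ j₃) (hc₁ : cval I B j₁ = 1) (hc₂ : cval I B j₂ = 1) (hc₃ : cval I B j₃ = 1) :
    finrank (ZMod 2) (rad (polarDir I B (1, 0))) + 6 ≤ finrank (ZMod 2) (Fin n → ZMod 2) := by
  -- an AND variable of one private edge is off the pair of another
  have hoff : ∀ {j k : Fin m}, Controlled I B j → Controlled I B k → j ≠ k → ∀ s : Fin 4, (s = 2 ∨ s = 3) →
      I.vars j s ≠ I.vars k 2 ∧ I.vars j s ≠ I.vars k 3 := by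
    intro j k hj hk hne s hs
    have h := hj.1.2 k (mem_sdiff.1 hk.1.1).1 (Ne.symm hne)
    have : I.vars j s ∉ varSet I k := by rcases hs with rfl | rfl; exacts [h.1, h.2]
    exact ⟨fun e => this (e ▸ vars_mem_varSet I k 2), fun e => this (e ▸ vars_mem_varSet I k 3)⟩
  -- orthogonality of the pairs of two distinct controlled edges
  have horth : ∀ {j k : Fin m}, Controlled I B j → Controlled I B k → j ≠ k →
      polarDir I B (1, 0) (Pi.single (I.vars j 2) 1) (Pi.single (I.vars k 2) 1) = 0 ∧
      polarDir I B (1, 0) (Pi.single (I.vars j 2) 1) (Pi.single (I.vars k 3) 1) = 0 ∧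
      polarDir I B (1, 0) (Pi.single (I.vars j 3) 1) (Pi.single (I.vars k 2) 1) = 0 ∧
      polarDir I B (1, 0) (Pi.single (I.vars j 3) 1) (Pi.single (I.vars k 3) 1) = 0 := by
    intro j k hj hk hne
    have h2 := hoff hj hk hne 2 (Or.inl rfl)
    have h3 := hoff hj hk hne 3 (Or.inr rfl)
    exact ⟨(hk.2 2 (Or.inl rfl)).2 _ h2.1 h2.2, (hk.2 3 (Or.inr rfl)).2 _ h2.1 h2.2,
      (hk.2 2 (Or.inl rfl)).2 _ h3.1 h3.2, (hk.2 3 (Or.inr rfl)).2 _ h3.1 h3.2⟩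
  have hne : ∀ {j : Fin m}, cval I B j = 1 → polarDir I B (1, 0) (Pi.single (I.vars j 2) 1) (Pi.single (I.vars j 3) 1) ≠ 0 := by
    intro j hc h
    rw [polarDir_symm, show polarDir I B (1, 0) (Pi.single (I.vars j 3) 1) (Pi.single (I.vars j 2) 1) = cval I B j from rfl, hc] at h
    exact one_ne_zero h
  exact finrank_rad_add_six_le (polarDir_self I (1, 0)) (polarDir_symm I (1, 0)) (hne hc₁) (hne hc₂) (hne hc₃)
    (horth h₁ h₂ h12) (horth h₁ h₃ h13) (horth h₂ h₃ h23)

/-- **`q_{(0,1)} ≡ 0` or `q_{(0,1)} = q_{(1,0)}`** in node N1, given three controlled private edges with `c_j = 1`. -/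
theorem qDir01_dichotomy (hI : I.IsPure xorAndPred) (hT : Typed I) (hD : CrossData I r B e_p e_q g₀) (hSR : ((sys I B).vsys e_p e_q).SingleRead)
    (hE : (B.N.erase e_q).erase e_p = ∅) {j₁ j₂ j₃ : Fin m} (h₁ : Controlled I B j₁) (h₂ : Controlled I B j₂) (h₃ : Controlled I B j₃)
    (h12 : j₁ ≠ j₂) (h13 : j₁ ≠ j₃) (h23 : j₂ ≠ j₃) (hc₁ : cval I B j₁ = 1) (hc₂ : cval I B j₂ = 1) (hc₃ : cval I B j₃ = 1) :
    (∀ x, qDir I B (0, 1) x = 0) ∨ (∀ x, qDir I B (0, 1) x = qDir I B (1, 0) x) :=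
  eq_zero_or_eq_of_rank_six (qDir_add I B (1, 0)) (rank_six_of_controlled I h₁ h₂ h₃ h12 h13 h23 hc₁ hc₂ hc₃)
    ⟨polarDir I B (0, 1), qDir_add I B (0, 1)⟩ (fun _ hx => qDir01_zero_of_q I hI hT hD hSR hE hx)

/-- **The first constraint touches no controlled private edge**, once `q_{(0,1)} ∈ {0, q_{(1,0)}}`. -/
theorem w₁_untouched (hI : I.IsPure xorAndPred) (hT : Typed I) (hS : SimpleOverlap I) (hD : CrossData I r B e_p e_q g₀) {π : Fin m}
    (hπ : Controlled I B π) (hg : (∀ x, qDir I B (0, 1) x = 0) ∨ (∀ x, qDir I B (0, 1) x = qDir I B (1, 0) x)) :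
    (I.vars π 2 ∉ B.C₁ ∧ I.vars π 3 ∉ B.C₁) ∧
      ∀ g ∈ B.G₁, I.vars g 2 ≠ I.vars π 2 ∧ I.vars g 3 ≠ I.vars π 2 ∧ I.vars g 2 ≠ I.vars π 3 ∧ I.vars g 3 ≠ I.vars π 3 := by
  -- the polar form of `g₁` is `0` or `β`
  have hpol : ∀ x y, polarDir I B (0, 1) x y = 0 ∨ polarDir I B (0, 1) x y = polarDir I B (1, 0) x y := by
    intro x y
    have e01 := qDir_add I B (0, 1) x y
    rcases hg with h | h
    · left
      rw [h, h, h, h] at e01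
      have e : ∀ b : ZMod 2, (0 : ZMod 2) = 0 + 0 + 0 + b → b = 0 := by decide
      exact e _ e01
    · right
      rw [h, h, h, h, qDir_add I B (1, 0) x y] at e01
      have e : ∀ a b c d d' : ZMod 2, a + b + c + d = a + b + c + d' → d' = d := by decide
      exact e _ _ _ _ _ e01
  -- the linear coefficient and the off-pair polars of `g₁` at the AND variables of `π`
  have hlin : ∀ s : Fin 4, (s = 2 ∨ s = 3) → qDir I B (0, 1) (Pi.single (I.vars π s) 1) = qDir I B (0, 1) 0 := by
    intro s hs
    rcases hg with h | h
    · rw [h, h]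
    · rw [h, h]; exact (hπ.2 s hs).1
  have hoff : ∀ s : Fin 4, (s = 2 ∨ s = 3) → ∀ w, w ≠ I.vars π 2 → w ≠ I.vars π 3 →
      polarDir I B (0, 1) (Pi.single w 1) (Pi.single (I.vars π s) 1) = 0 := by
    intro s hs w hw2 hw3
    rcases hpol (Pi.single w 1) (Pi.single (I.vars π s) 1) with h | h
    · exact h
    · rw [h]; exact (hπ.2 s hs).2 w hw2 hw3
  have hC : ∀ s : Fin 4, (s = 2 ∨ s = 3) → I.vars π s ∉ B.C₁ := fun s hs =>
    (not_mem_C_of_qDir I hI hT hD.wf hπ.1.1 (by rcases hs with rfl | rfl <;> decide)).1 (hlin s hs)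
  have hG : ∀ s : Fin 4, (s = 2 ∨ s = 3) → ∀ g ∈ B.G₁, I.vars g 2 ≠ I.vars π s ∧ I.vars g 3 ≠ I.vars π s := by
    intro s hs g hg
    have hgf : g ∈ freeMon I B.N B.G₁ := by
      refine mem_filter.2 ⟨hg, ?_⟩
      rintro (h2 | h3)
      · exact ((hD.hun _ h2).1 g hg).1 rfl
      · exact ((hD.hun _ h3).1 g hg).2 rfl
    have hd₁ : Disjoint B.G₁ B.J₀ := Finset.disjoint_of_subset_left (subset_insert g₀ B.G₁) hD.disj₁
    refine avoid_of_polar_zero_off_mate I hI hS (hD.wf.hT₁.trans sdiff_subset) hd₁ hπ.1 hs (fun w hw2 hw3 => ?_) g hgf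
    have h := hoff s hs w hw2 hw3
    rw [polarDir_single] at h
    simpa using h
  exact ⟨⟨hC 2 (Or.inl rfl), hC 3 (Or.inr rfl)⟩, fun g hg =>
    ⟨(hG 2 (Or.inl rfl) g hg).1, (hG 2 (Or.inl rfl) g hg).2, (hG 3 (Or.inr rfl) g hg).1, (hG 3 (Or.inr rfl) g hg).2⟩⟩

end

end Summit.PneNP.PneNP.Theorems.PstarCrossCasePEmptyW1
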